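/-
Copyright: the b2b-balaban T⁴-continuum CRUX team, row NE7b leaf lineage `t4-ne7b-formalise-leaf-06` (gen 152). Project licence.
-/
import Summits.QuantumFields.BalabanUV.T4Continuum.Spine.NE7b.HessianFormFirstOrder
import Summits.QuantumFields.BalabanUV.T4Continuum.Spine.NE7b.ConvexWindowSuppliersLocal
import Mathlib.Analysis.Calculus.MeanValue

/-!
# THE WINDOW HESSIAN FROM A THIRD-DERIVATIVE **READING** `‖D³P(z)[w,·,·]‖_op ≤ c·N(w)`, FOR A PERTURBATION `C³` ONLY ON AN OPEN
# SET CONTAINING THE WINDOW: the `ContDiffOn` companion of `…ConvexWindowSuppliersBox` §1–§3 and of the ENDs of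
# `…ConvexWindowSuppliersLocal` §4 — the INTENSIVE-constant road (`c∞ = ν·τ`, no `√n`) with every regularity hypothesis ON `U` only,
# which is what the analytic suppliers (`…AnalyticThirdDerivLetterLocal`: `τ = 27M∕δ³` from print's `(M, δ)`) can actually meet
# (row NE7b, node U5c; letter (ℓ1) of the windowed road; [folklore])

Cell `pub-balaban`, sub-cell `t4`, spine estimate NE7b (`T4WeightBudget.RelWeightBound`; the cell's OWN estimate — NOT PRINTED in
[Bałaban 1983–89], NOT PROVED).  Crux-route work under `Spine/NE7b/` by a row leaf on the convexity road; NOTHING of Bałaban's is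
named, valued or asserted; no `T4Continuum/Support` leaf typed; no `def`; zero `sorry`.  Imports: leaf-03's `…HessianFormFirstOrder`
(§5, the `ContDiffOn` first-order engine, BY NAME), leaf-02's `…ConvexWindowSuppliersLocal` (the Schur ∕ locality readings of the
third-derivative table, BY NAME — they carry no regularity hypothesis) and Mathlib's mean value inequality on `[0, 1]`.

WHY.  `…ConvexWindowSuppliersBox` §1–§3 (leaf-02) cure the `√n` of the operator-norm road: from the READING letter
`‖D³P(z)[w,·,·]‖_op ≤ c·N(w)` ON a convex window `K` (`N` any size reading of the direction — the sup norm, a block sup norm) the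
Hessian moves by at most `c·N(y − x)` between points of `K`, so the modulus ON `K` is `2σ − (‖D²P(x₀)‖ + c·ρ)` with `ρ` the `N`-size of
the window about `x₀`; `…ConvexWindowSuppliersLocal` §3–§4 make `c` INTENSIVE for a LOCAL perturbation (`c∞ = ν·τ`: `ν` live index
triples per coordinate, `τ` the largest entry).  Both files ask `ContDiff ℝ 3 P` on the WHOLE space.  The suppliers of `τ` in print's
currency are real parts of functionals ANALYTIC ON A COMPLEX NEIGHBOURHOOD of the window (`…AnalyticThirdDerivLetterLocal`, this
lineage: entries vanish off `S³`, `|entry| ≤ 27M∕δ³`) — `ContDiffOn` on the real preimage of that neighbourhood and nothing globally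
(located INFO ι-leaf06-g150-1 ∕ refuter R-AHL-g83-1: «the sockets' global `C³` display is unmeetable by functionals analytic only near
the window»).  The sibling `…WindowHessianFromThirdDeriv` (gen 151) typed the `ContDiffOn` companion of the OPERATOR-NORM road
(`‖D³Φ‖ ≤ c₃`); THIS FILE types it for the READING road and re-derives leaf-02's three ENDs (fibre sums, local table, model window
`L ∩ box(x₀, a)`) with `P ∈ C³(U)`, `K ⊆ U` — so the chain «print's `(M, δ, S)` ⟹ `(τ, ν)` ⟹ `λ = 2σ − (‖D²P(x₀)‖ + ν·τ·a)` ON the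
model window ⟹ the road's letter» closes with every regularity hypothesis ON `U` only (the last junction with
`…AnalyticThirdDerivLetterLocal` is one `exact`, kept as a certificate until that file has a hub olean).

WHAT IS PROVED ([folklore]; `E` a real normed space, `U ⊆ E` open, `K ⊆ U` convex, `N : E → ℝ` ANY function, `Φ : E → F` resp.
`E → ℝ` with `ContDiffOn ℝ 3 Φ U`, `hP3 : ∀ z ∈ K, ∀ w, ‖fderiv ℝ (iteratedFDeriv ℝ 2 Φ) z w‖ ≤ c·N w` — the global `iteratedFDeriv`
AT points of the open `U`, where it is meaningful):
* §1 **`norm_hessian_sub_le_of_thirdDerivReadingOn`** — `∀ x y ∈ K, ‖D²Φ(y) − D²Φ(x)‖ ≤ c·N(y − x)` (the segment stays in `K`; along it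
  `τ ↦ D²Φ(x + τ(y − x))` has derivative `D³Φ(·)[y − x]`, differentiable AT the points of `U` by `ContDiffAt.differentiableAt_iteratedFDeriv`;
  Mathlib's mean value inequality on `[0, 1]` sees only that one direction).
* §2 ABOUT A CENTRE `x₀ ∈ K` with `N(x − x₀) ≤ ρ` on `K`, `0 ≤ c`: `norm_hessian_le_of_thirdDerivReadingOn` (`‖D²Φ(x)‖ ≤ ‖D²Φ(x₀)‖ + cρ`
  — leaf-02's two-centre shape, ON `U`), `abs_hessian_sub_le_of_thirdDerivReadingOn`, **`hessianOn_lower_of_thirdDerivReadingOn`**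
  (`D²Φ(x₀)[v,v] − cρ‖v‖² ≤ D²Φ(x)[v,v]` — the centre's form KEPT), `hessianOn_upper_of_thirdDerivReadingOn`,
  `hessianOn_floor_of_thirdDerivReadingOn` (a floor `2σ‖v‖²` AT the centre is the floor `(2σ − cρ)‖v‖²` ON `K`) and
  `hessianOn_lower_norm_of_thirdDerivReadingOn` (no floor asked: `−(‖D²Φ(x₀)‖ + cρ)‖v‖² ≤ D²Φ(x)[v,v]` — the perturbation's shape).
* §3 THE ENDS FOR `Φ`, leaf-03's §5 BY NAME: **`firstOrderOn_of_thirdDerivReadingOn`** (`fderiv` currency, modulus `2σ − cρ`),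
  `firstOrderOn_of_thirdDerivReadingOn_gradient`, and the perturbation's letter `firstOrderOn_norm_of_thirdDerivReadingOn_gradient`
  (modulus `−(‖D²P(x₀)‖ + cρ)` ON `K` for `P ∈ C³(U)`).
* §4 THE QUADRATIC-PLUS-PERTURBATION SHAPE ON `U` (`EuclideanSpace ℝ (Fin n)`, leaf-02's END currency): `firstOrderOn_add_of_differentiableAt`
  (moduli add ON `K` for summands differentiable AT the points of `K` — the OWNER's `firstOrderOn_add` asks global differentiability) and
  **`firstOrderOn_quadratic_add_of_thirdDerivReadingOn`**: `A` symmetric `σ`-coercive, `P ∈ C³(U)`, the reading letter ON `K` ⟹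
  `⟪·,A·⟫ + P` has the road's first-order letter ON `K` with modulus `2σ − (‖D²P(x₀)‖ + c·ρ)` — VERBATIM leaf-02's
  `…Box.firstOrderOn_quadratic_add_of_thirdDeriv_reading` with `ContDiff ℝ 3 P` weakened to `ContDiffOn ℝ 3 P U`, `K ⊆ U`.
* §5 THE THREE LOCAL ENDS ON `U`, leaf-02's readings BY NAME: `firstOrderOn_quadratic_add_of_fibreSumsOn` (fibre sums `≤ M` ⟹
  `2σ − (‖D²P(x₀)‖ + M·ρ∞)`), **`firstOrderOn_quadratic_add_of_localOn`** (interaction set `N`, entry bound `τ`, count `ν` ⟹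
  `2σ − (‖D²P(x₀)‖ + ν·τ·ρ∞)`) and **`firstOrderOn_quadratic_add_of_localOn_subspace_inter_coordBox`** (the model window `L ∩ box(x₀, a)`,
  `box ⊆ U`: modulus `2σ − (‖D²P(x₀)‖ + ν·τ·a)`, every structural hypothesis discharged — the displayed numbers are `σ`, `τ`, `ν`, `a`).
* §6 junction check (kernel): with `U = univ` §4 gives back leaf-02's global-`C³` END (one `exact`).

NOT HERE (honest): the numbers `σ`, `τ`, `ν`, `a`, the interaction set and the identification of `P` for Bałaban's steps — (A3) ∕ (A1c),
NC-NE7b-α UNRULED; the analytic supply of the table (`…AnalyticThirdDerivLetterLocal`, no hub olean yet — the junction is one `exact`);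
the block-window END of `…ConvexWindowSuppliersLocal` §5 (same two-line pattern over `thirdDeriv_reading_of_blockFibreSums`; left to a
v1.x on request to stay under the c5 limit); mass-insertion power counting of UNSUBTRACTED inherited terms (refuter R-AHL-g83-1 (c):
print's gauge invariance + `β` counter-terms do the subtraction — not a calculus fact); anything of Bałaban's.  BY-NAME EFFECT ON THE
WALL: NONE (a socket-side companion).  NE7b NOT PRINTED ∕ NOT PROVED; spine PROVED 0∕9; rung (B)+1 on a FINITE torus — NOT infinite
volume, NOT the mass gap, NOT Clay.
HONEST DEPENDENCY: continuum YM on T⁴ ⇐ BetaPertH ∧ nine spine estimates (0/9 proved); BetaPertH ⇐ (D1) ∧ (D4) ∧ CAP+tail; G-an2-4 gates asym,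
D1 and NE2∕3∕4.
-/

set_option autoImplicit false

noncomputable section

open Set Metric Finset
open scoped RealInnerProductSpace Gradient
open Summit.QuantumFields.BalabanUV.T4Continuum.NE7b.HessianFormFirstOrder
open Summit.QuantumFields.BalabanUV.T4Continuum.NE7b.ConvexTiltSuppliers
open Summit.QuantumFields.BalabanUV.T4Continuum.NE7b.ConvexWindowSuppliersBox
open Summit.QuantumFields.BalabanUV.T4Continuum.NE7b.ConvexWindowSuppliersLocal

namespace Summit.QuantumFields.BalabanUV.T4Continuum.NE7b.WindowHessianFromThirdDerivReading

/-! ## §1 The reading letter ON a convex window inside the smoothness domain ⟹ the Hessian moves by `c·N(y − x)` -/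

section Reading

variable {E : Type*} [NormedAddCommGroup E] [NormedSpace ℝ E] {F : Type*} [NormedAddCommGroup F] [NormedSpace ℝ F]

/-- **MEAN VALUE FOR THE HESSIAN IN ANY READING OF THE DIRECTION, ON `U`.**  `U` open, `K ⊆ U` convex, `Φ ∈ C³(U)`, `N : E → ℝ` any
function, and ON `K` the letter `‖D³Φ(z)[w,·,·]‖_op ≤ c·N(w)` (all directions `w`) ⟹ for `x, y ∈ K`: `‖D²Φ(y) − D²Φ(x)‖ ≤ c·N(y − x)`.
[folklore] -/
theorem norm_hessian_sub_le_of_thirdDerivReadingOn {Φ : E → F} (N : E → ℝ) {U K : Set E} {c : ℝ} (hU : IsOpen U) (hKU : K ⊆ U)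
    (hK : Convex ℝ K) (hΦ : ContDiffOn ℝ 3 Φ U)
    (hP3 : ∀ z ∈ K, ∀ w : E, ‖fderiv ℝ (iteratedFDeriv ℝ 2 Φ) z w‖ ≤ c * N w) {x y : E} (hx : x ∈ K) (hy : y ∈ K) :
    ‖iteratedFDeriv ℝ 2 Φ y - iteratedFDeriv ℝ 2 Φ x‖ ≤ c * N (y - x) := by
  have hd : ∀ z ∈ K, DifferentiableAt ℝ (iteratedFDeriv ℝ 2 Φ) z := fun z hz =>
    (hΦ.contDiffAt (hU.mem_nhds (hKU hz))).differentiableAt_iteratedFDeriv (by norm_num)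
  set ξ : E := y - x with hξ
  have hseg : ∀ τ ∈ Icc (0 : ℝ) 1, x + τ • ξ ∈ K := fun τ hτ =>
    hK.add_smul_mem hx (by rw [hξ, add_sub_cancel]; exact hy) hτ
  set g : ℝ → (E [×2]→L[ℝ] F) := fun τ => iteratedFDeriv ℝ 2 Φ (x + τ • ξ) with hg
  have hline : ∀ τ : ℝ, HasDerivAt (fun t : ℝ => x + t • ξ) ξ τ := fun τ => by
    simpa using ((hasDerivAt_id τ).smul_const ξ).const_add x
  have hder : ∀ τ ∈ Icc (0 : ℝ) 1,
      HasDerivWithinAt g (fderiv ℝ (iteratedFDeriv ℝ 2 Φ) (x + τ • ξ) ξ) (Icc (0 : ℝ) 1) τ := fun τ hτ =>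
    ((hd _ (hseg τ hτ)).hasFDerivAt.comp_hasDerivAt τ (hline τ)).hasDerivWithinAt
  have hbound : ∀ τ ∈ Ico (0 : ℝ) 1, ‖fderiv ℝ (iteratedFDeriv ℝ 2 Φ) (x + τ • ξ) ξ‖ ≤ c * N ξ :=
    fun τ hτ => hP3 _ (hseg τ (Ico_subset_Icc_self hτ)) ξ
  have hmv := norm_image_sub_le_of_norm_deriv_le_segment_01' hder hbound
  have h1 : g 1 = iteratedFDeriv ℝ 2 Φ y := by simp [hg, hξ]
  rwa [h1, show g 0 = iteratedFDeriv ℝ 2 Φ x by simp [hg]] at hmv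

end Reading

/-! ## §2 About a centre `x₀ ∈ K` of `N`-size `ρ`: the Hessian ON the window from the Hessian AT the centre -/

section Centre

variable {E : Type*} [NormedAddCommGroup E] [NormedSpace ℝ E] {F : Type*} [NormedAddCommGroup F] [NormedSpace ℝ F]

/-- **LEAF-02's TWO-CENTRE SHAPE, ON `U`**: `‖D²Φ(x)‖ ≤ ‖D²Φ(x₀)‖ + c·ρ` for `x ∈ K` (`x₀ ∈ K`, `N(x − x₀) ≤ ρ` on `K`, `0 ≤ c`).
[folklore] -/
theorem norm_hessian_le_of_thirdDerivReadingOn {Φ : E → F} (N : E → ℝ) {U K : Set E} {c ρ : ℝ} {x₀ : E} (hU : IsOpen U)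
    (hKU : K ⊆ U) (hK : Convex ℝ K) (h0 : x₀ ∈ K) (hKρ : ∀ x ∈ K, N (x - x₀) ≤ ρ) (hΦ : ContDiffOn ℝ 3 Φ U) (hc : 0 ≤ c)
    (hP3 : ∀ z ∈ K, ∀ w : E, ‖fderiv ℝ (iteratedFDeriv ℝ 2 Φ) z w‖ ≤ c * N w) {x : E} (hx : x ∈ K) :
    ‖iteratedFDeriv ℝ 2 Φ x‖ ≤ ‖iteratedFDeriv ℝ 2 Φ x₀‖ + c * ρ := by
  have hmv := norm_hessian_sub_le_of_thirdDerivReadingOn N hU hKU hK hΦ hP3 h0 hx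
  calc ‖iteratedFDeriv ℝ 2 Φ x‖ = ‖iteratedFDeriv ℝ 2 Φ x₀ + (iteratedFDeriv ℝ 2 Φ x - iteratedFDeriv ℝ 2 Φ x₀)‖ := by
        rw [add_sub_cancel]
    _ ≤ ‖iteratedFDeriv ℝ 2 Φ x₀‖ + ‖iteratedFDeriv ℝ 2 Φ x - iteratedFDeriv ℝ 2 Φ x₀‖ := norm_add_le _ _
    _ ≤ ‖iteratedFDeriv ℝ 2 Φ x₀‖ + c * ρ := by
        refine add_le_add le_rfl (hmv.trans ?_)
        exact mul_le_mul_of_nonneg_left (hKρ x hx) hc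

/-- The diagonal entries move by at most `cρ‖v‖²` across the window: `|D²Φ(x)[v,v] − D²Φ(x₀)[v,v]| ≤ cρ‖v‖²`. [folklore] -/
theorem abs_hessian_sub_le_of_thirdDerivReadingOn {Φ : E → ℝ} (N : E → ℝ) {U K : Set E} {c ρ : ℝ} {x₀ : E} (hU : IsOpen U)
    (hKU : K ⊆ U) (hK : Convex ℝ K) (h0 : x₀ ∈ K) (hKρ : ∀ x ∈ K, N (x - x₀) ≤ ρ) (hΦ : ContDiffOn ℝ 3 Φ U) (hc : 0 ≤ c)
    (hP3 : ∀ z ∈ K, ∀ w : E, ‖fderiv ℝ (iteratedFDeriv ℝ 2 Φ) z w‖ ≤ c * N w) {x : E} (hx : x ∈ K) (v : E) :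
    |iteratedFDeriv ℝ 2 Φ x ![v, v] - iteratedFDeriv ℝ 2 Φ x₀ ![v, v]| ≤ c * ρ * ‖v‖ ^ 2 := by
  have hmv := norm_hessian_sub_le_of_thirdDerivReadingOn N hU hKU hK hΦ hP3 h0 hx
  have hD : ‖iteratedFDeriv ℝ 2 Φ x - iteratedFDeriv ℝ 2 Φ x₀‖ ≤ c * ρ := hmv.trans (mul_le_mul_of_nonneg_left (hKρ x hx) hc)
  have hop := (iteratedFDeriv ℝ 2 Φ x - iteratedFDeriv ℝ 2 Φ x₀).le_opNorm ![v, v]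
  simp only [Fin.prod_univ_two, Matrix.cons_val_zero, Matrix.cons_val_one, Real.norm_eq_abs,
    _root_.sub_apply] at hop
  calc |iteratedFDeriv ℝ 2 Φ x ![v, v] - iteratedFDeriv ℝ 2 Φ x₀ ![v, v]|
        ≤ ‖iteratedFDeriv ℝ 2 Φ x - iteratedFDeriv ℝ 2 Φ x₀‖ * (‖v‖ * ‖v‖) := hop
    _ ≤ c * ρ * (‖v‖ * ‖v‖) := mul_le_mul_of_nonneg_right hD (by positivity)
    _ = c * ρ * ‖v‖ ^ 2 := by ring

/-- **HESSIAN LOWER DISPLAY ON THE WINDOW FROM THE CENTRE** (the centre's form is KEPT): `D²Φ(x₀)[v,v] − cρ‖v‖² ≤ D²Φ(x)[v,v]` for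
`x ∈ K`. [folklore] -/
theorem hessianOn_lower_of_thirdDerivReadingOn {Φ : E → ℝ} (N : E → ℝ) {U K : Set E} {c ρ : ℝ} {x₀ : E} (hU : IsOpen U)
    (hKU : K ⊆ U) (hK : Convex ℝ K) (h0 : x₀ ∈ K) (hKρ : ∀ x ∈ K, N (x - x₀) ≤ ρ) (hΦ : ContDiffOn ℝ 3 Φ U) (hc : 0 ≤ c)
    (hP3 : ∀ z ∈ K, ∀ w : E, ‖fderiv ℝ (iteratedFDeriv ℝ 2 Φ) z w‖ ≤ c * N w) :
    ∀ x ∈ K, ∀ v : E, iteratedFDeriv ℝ 2 Φ x₀ ![v, v] - c * ρ * ‖v‖ ^ 2 ≤ iteratedFDeriv ℝ 2 Φ x ![v, v] := by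
  intro x hx v
  have h := (abs_le.1 (abs_hessian_sub_le_of_thirdDerivReadingOn N hU hKU hK h0 hKρ hΦ hc hP3 hx v)).1
  linarith

/-- **HESSIAN UPPER DISPLAY ON THE WINDOW FROM THE CENTRE**: `D²Φ(x)[v,v] ≤ D²Φ(x₀)[v,v] + cρ‖v‖²` for `x ∈ K`. [folklore] -/
theorem hessianOn_upper_of_thirdDerivReadingOn {Φ : E → ℝ} (N : E → ℝ) {U K : Set E} {c ρ : ℝ} {x₀ : E} (hU : IsOpen U)
    (hKU : K ⊆ U) (hK : Convex ℝ K) (h0 : x₀ ∈ K) (hKρ : ∀ x ∈ K, N (x - x₀) ≤ ρ) (hΦ : ContDiffOn ℝ 3 Φ U) (hc : 0 ≤ c)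
    (hP3 : ∀ z ∈ K, ∀ w : E, ‖fderiv ℝ (iteratedFDeriv ℝ 2 Φ) z w‖ ≤ c * N w) :
    ∀ x ∈ K, ∀ v : E, iteratedFDeriv ℝ 2 Φ x ![v, v] ≤ iteratedFDeriv ℝ 2 Φ x₀ ![v, v] + c * ρ * ‖v‖ ^ 2 := by
  intro x hx v
  have h := (abs_le.1 (abs_hessian_sub_le_of_thirdDerivReadingOn N hU hKU hK h0 hKρ hΦ hc hP3 hx v)).2
  linarith

/-- **A FLOOR AT THE CENTRE IS A FLOOR ON THE WINDOW, UP TO `cρ`**: `2σ‖v‖² ≤ D²Φ(x₀)[v,v]` for all `v` ⟹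
`(2σ − cρ)‖v‖² ≤ D²Φ(x)[v,v]` for `x ∈ K`, in the road's `2·Q(v) ≤ D²Φ(x)[v,v]` shape with `Q(v) = (σ − cρ∕2)‖v‖²`. [folklore] -/
theorem hessianOn_floor_of_thirdDerivReadingOn {Φ : E → ℝ} (N : E → ℝ) {U K : Set E} {c ρ σ : ℝ} {x₀ : E} (hU : IsOpen U)
    (hKU : K ⊆ U) (hK : Convex ℝ K) (h0 : x₀ ∈ K) (hKρ : ∀ x ∈ K, N (x - x₀) ≤ ρ) (hΦ : ContDiffOn ℝ 3 Φ U) (hc : 0 ≤ c)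
    (hP3 : ∀ z ∈ K, ∀ w : E, ‖fderiv ℝ (iteratedFDeriv ℝ 2 Φ) z w‖ ≤ c * N w)
    (hσ : ∀ v : E, 2 * σ * ‖v‖ ^ 2 ≤ iteratedFDeriv ℝ 2 Φ x₀ ![v, v]) :
    ∀ x ∈ K, ∀ v : E, 2 * ((σ - c * ρ / 2) * ‖v‖ ^ 2) ≤ iteratedFDeriv ℝ 2 Φ x ![v, v] := by
  intro x hx v
  have h := hessianOn_lower_of_thirdDerivReadingOn N hU hKU hK h0 hKρ hΦ hc hP3 x hx v
  nlinarith [hσ v]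

/-- **NO FLOOR ASKED — THE PERTURBATION's SHAPE**: `−(‖D²Φ(x₀)‖ + cρ)‖v‖² ≤ D²Φ(x)[v,v]` for `x ∈ K`, in the road's `2·Q(v)` shape with
`Q(v) = −((‖D²Φ(x₀)‖ + cρ)∕2)‖v‖²`. [folklore] -/
theorem hessianOn_lower_norm_of_thirdDerivReadingOn {Φ : E → ℝ} (N : E → ℝ) {U K : Set E} {c ρ : ℝ} {x₀ : E} (hU : IsOpen U)
    (hKU : K ⊆ U) (hK : Convex ℝ K) (h0 : x₀ ∈ K) (hKρ : ∀ x ∈ K, N (x - x₀) ≤ ρ) (hΦ : ContDiffOn ℝ 3 Φ U) (hc : 0 ≤ c)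
    (hP3 : ∀ z ∈ K, ∀ w : E, ‖fderiv ℝ (iteratedFDeriv ℝ 2 Φ) z w‖ ≤ c * N w) :
    ∀ x ∈ K, ∀ v : E, 2 * (-((‖iteratedFDeriv ℝ 2 Φ x₀‖ + c * ρ) / 2) * ‖v‖ ^ 2) ≤ iteratedFDeriv ℝ 2 Φ x ![v, v] := by
  intro x hx v
  have hn := norm_hessian_le_of_thirdDerivReadingOn N hU hKU hK h0 hKρ hΦ hc hP3 hx
  have hop := (iteratedFDeriv ℝ 2 Φ x).le_opNorm ![v, v]
  simp only [Fin.prod_univ_two, Matrix.cons_val_zero, Matrix.cons_val_one, Real.norm_eq_abs] at hop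
  have h1 : |iteratedFDeriv ℝ 2 Φ x ![v, v]| ≤ (‖iteratedFDeriv ℝ 2 Φ x₀‖ + c * ρ) * (‖v‖ * ‖v‖) :=
    hop.trans (mul_le_mul_of_nonneg_right hn (by positivity))
  have h2 := (abs_le.1 h1).1
  nlinarith

end Centre

/-! ## §3 THE ENDS for `Φ` ON the window, leaf-03's `ContDiffOn` engine BY NAME -/

section End

variable {E : Type*} [NormedAddCommGroup E] [NormedSpace ℝ E]

/-- **THE FIRST-ORDER LETTER ON THE WINDOW FROM `(σ, c, ρ)` IN THE READING `N`, EVERYTHING ON `U`** (`fderiv` currency): `U` open,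
`K ⊆ U` convex, `x₀ ∈ K`, `N(x − x₀) ≤ ρ` on `K`, `Φ ∈ C³(U)`, the reading letter ON `K` with `0 ≤ c`, `2σ‖v‖² ≤ D²Φ(x₀)[v,v]` ⟹ for all
`x, y ∈ K`, `Φ x + DΦ(x)(y − x) + (σ − cρ∕2)‖y − x‖² ≤ Φ y` — modulus `λ = 2σ − cρ` ON the window. [folklore] -/
theorem firstOrderOn_of_thirdDerivReadingOn {Φ : E → ℝ} (N : E → ℝ) {U K : Set E} {c ρ σ : ℝ} {x₀ : E} (hU : IsOpen U)
    (hKU : K ⊆ U) (hK : Convex ℝ K) (h0 : x₀ ∈ K) (hKρ : ∀ x ∈ K, N (x - x₀) ≤ ρ) (hΦ : ContDiffOn ℝ 3 Φ U) (hc : 0 ≤ c)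
    (hP3 : ∀ z ∈ K, ∀ w : E, ‖fderiv ℝ (iteratedFDeriv ℝ 2 Φ) z w‖ ≤ c * N w)
    (hσ : ∀ v : E, 2 * σ * ‖v‖ ^ 2 ≤ iteratedFDeriv ℝ 2 Φ x₀ ![v, v]) :
    ∀ x ∈ K, ∀ y ∈ K, Φ x + fderiv ℝ Φ x (y - x) + (σ - c * ρ / 2) * ‖y - x‖ ^ 2 ≤ Φ y :=
  firstOrderOn_form_of_hessianOn_lower_fderiv_of_contDiffOn hU hKU hK (hΦ.of_le (by norm_num))
    (fun v => (σ - c * ρ / 2) * ‖v‖ ^ 2) (hessianOn_floor_of_thirdDerivReadingOn N hU hKU hK h0 hKρ hΦ hc hP3 hσ)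

/-- The same in gradient currency (complete real inner-product space): `Φ x + ⟪∇Φ x, y − x⟫ + (σ − cρ∕2)‖y − x‖² ≤ Φ y` on `K`.
[folklore] -/
theorem firstOrderOn_of_thirdDerivReadingOn_gradient {H : Type*} [NormedAddCommGroup H] [InnerProductSpace ℝ H] [CompleteSpace H]
    {Φ : H → ℝ} (N : H → ℝ) {U K : Set H} {c ρ σ : ℝ} {x₀ : H} (hU : IsOpen U) (hKU : K ⊆ U) (hK : Convex ℝ K) (h0 : x₀ ∈ K)
    (hKρ : ∀ x ∈ K, N (x - x₀) ≤ ρ) (hΦ : ContDiffOn ℝ 3 Φ U) (hc : 0 ≤ c)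
    (hP3 : ∀ z ∈ K, ∀ w : H, ‖fderiv ℝ (iteratedFDeriv ℝ 2 Φ) z w‖ ≤ c * N w)
    (hσ : ∀ v : H, 2 * σ * ‖v‖ ^ 2 ≤ iteratedFDeriv ℝ 2 Φ x₀ ![v, v]) :
    ∀ x ∈ K, ∀ y ∈ K, Φ x + ⟪gradient Φ x, y - x⟫ + (σ - c * ρ / 2) * ‖y - x‖ ^ 2 ≤ Φ y :=
  firstOrderOn_form_of_hessianOn_lower_of_contDiffOn hU hKU hK (hΦ.of_le (by norm_num))
    (fun v => (σ - c * ρ / 2) * ‖v‖ ^ 2) (hessianOn_floor_of_thirdDerivReadingOn N hU hKU hK h0 hKρ hΦ hc hP3 hσ)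

/-- **THE PERTURBATION's LETTER ON THE WINDOW, NO FLOOR ASKED** (gradient currency): `P ∈ C³(U)` with the reading letter ON `K` ⟹
`P x + ⟪∇P x, y − x⟫ + (−(‖D²P(x₀)‖ + cρ))∕2 · ‖y − x‖² ≤ P y` for `x, y ∈ K` — semiconvexity ON `K` with the two-centre constant. [folklore] -/
theorem firstOrderOn_norm_of_thirdDerivReadingOn_gradient {H : Type*} [NormedAddCommGroup H] [InnerProductSpace ℝ H]
    [CompleteSpace H] {P : H → ℝ} (N : H → ℝ) {U K : Set H} {c ρ : ℝ} {x₀ : H} (hU : IsOpen U) (hKU : K ⊆ U) (hK : Convex ℝ K)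
    (h0 : x₀ ∈ K) (hKρ : ∀ x ∈ K, N (x - x₀) ≤ ρ) (hP : ContDiffOn ℝ 3 P U) (hc : 0 ≤ c)
    (hP3 : ∀ z ∈ K, ∀ w : H, ‖fderiv ℝ (iteratedFDeriv ℝ 2 P) z w‖ ≤ c * N w) :
    ∀ x ∈ K, ∀ y ∈ K, P x + ⟪gradient P x, y - x⟫ + (-(‖iteratedFDeriv ℝ 2 P x₀‖ + c * ρ)) / 2 * ‖y - x‖ ^ 2 ≤ P y := by
  intro x hx y hy
  have h := firstOrderOn_form_of_hessianOn_lower_of_contDiffOn hU hKU hK (hP.of_le (by norm_num))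
    (fun v => -((‖iteratedFDeriv ℝ 2 P x₀‖ + c * ρ) / 2) * ‖v‖ ^ 2)
    (hessianOn_lower_norm_of_thirdDerivReadingOn N hU hKU hK h0 hKρ hP hc hP3) x hx y hy
  have e : -((‖iteratedFDeriv ℝ 2 P x₀‖ + c * ρ) / 2) * ‖y - x‖ ^ 2 =
      (-(‖iteratedFDeriv ℝ 2 P x₀‖ + c * ρ)) / 2 * ‖y - x‖ ^ 2 := by ring
  rw [e] at h
  exact h

end End

/-! ## §4 The quadratic-plus-perturbation shape ON `U` (leaf-02's END currency on `EuclideanSpace ℝ (Fin n)`) -/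

section Quadratic

variable {n : ℕ}

/-- **MODULI ADD ON A WINDOW, SUMMANDS DIFFERENTIABLE AT THE POINTS OF THE WINDOW ONLY** (the OWNER's `firstOrderOn_add` asks global
differentiability — unmeetable by a perturbation smooth only near the window). [folklore] -/
theorem firstOrderOn_add_of_differentiableAt {H : Type*} [NormedAddCommGroup H] [InnerProductSpace ℝ H] [CompleteSpace H]
    {V₁ V₂ : H → ℝ} {l₁ l₂ : ℝ} {K : Set H} (h₁ : ∀ x ∈ K, DifferentiableAt ℝ V₁ x) (h₂ : ∀ x ∈ K, DifferentiableAt ℝ V₂ x)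
    (hV₁ : ∀ x ∈ K, ∀ y ∈ K, V₁ x + ⟪gradient V₁ x, y - x⟫ + l₁ / 2 * ‖y - x‖ ^ 2 ≤ V₁ y)
    (hV₂ : ∀ x ∈ K, ∀ y ∈ K, V₂ x + ⟪gradient V₂ x, y - x⟫ + l₂ / 2 * ‖y - x‖ ^ 2 ≤ V₂ y) :
    ∀ x ∈ K, ∀ y ∈ K,
      (V₁ x + V₂ x) + ⟪gradient (fun z => V₁ z + V₂ z) x, y - x⟫ + (l₁ + l₂) / 2 * ‖y - x‖ ^ 2 ≤ V₁ y + V₂ y := by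
  intro x hx y hy
  have hg : gradient (fun z => V₁ z + V₂ z) x = gradient V₁ x + gradient V₂ x := by
    have e1 : HasFDerivAt V₁ (InnerProductSpace.toDual ℝ H (gradient V₁ x)) x :=
      hasGradientAt_iff_hasFDerivAt.1 (h₁ x hx).hasGradientAt
    have e2 : HasFDerivAt V₂ (InnerProductSpace.toDual ℝ H (gradient V₂ x)) x :=
      hasGradientAt_iff_hasFDerivAt.1 (h₂ x hx).hasGradientAt
    have e12 := e1.add e2
    rw [← (InnerProductSpace.toDual ℝ H).map_add] at e12
    exact (hasGradientAt_iff_hasFDerivAt.2 e12).gradient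
  rw [hg, inner_add_left]
  have a := hV₁ x hx y hy
  have b := hV₂ x hx y hy
  linarith

/-- **COERCIVE QUADRATIC FORM PLUS A PERTURBATION `C³` ONLY ON `U`, THE READING LETTER ON THE WINDOW**: `A` symmetric with
`⟪v, Av⟫ ≥ σ‖v‖²`; `U` open, `K ⊆ U` convex, `x₀ ∈ K`, `N(x − x₀) ≤ ρ` on `K`; `P ∈ C³(U)` with `‖D³P(z)[w,·,·]‖_op ≤ c·N(w)` ON `K`,
`0 ≤ c` ⟹ for all `x, y ∈ K`,
`(⟪x,Ax⟫ + P x) + ⟪∇(⟪·,A·⟫ + P)(x), y − x⟫ + (2σ − (‖D²P(x₀)‖ + cρ))∕2 · ‖y − x‖² ≤ ⟪y,Ay⟫ + P y`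
— leaf-02's `…Box.firstOrderOn_quadratic_add_of_thirdDeriv_reading` with `ContDiff ℝ 3 P` weakened to `ContDiffOn ℝ 3 P U`. [folklore] -/
theorem firstOrderOn_quadratic_add_of_thirdDerivReadingOn (A : EuclideanSpace ℝ (Fin n) →L[ℝ] EuclideanSpace ℝ (Fin n))
    (N : EuclideanSpace ℝ (Fin n) → ℝ) {σ c ρ : ℝ} {U K : Set (EuclideanSpace ℝ (Fin n))} {x₀ : EuclideanSpace ℝ (Fin n)}
    (hU : IsOpen U) (hKU : K ⊆ U) (hK : Convex ℝ K) (h0 : x₀ ∈ K) (hKρ : ∀ x ∈ K, N (x - x₀) ≤ ρ)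
    (hA : ∀ v w : EuclideanSpace ℝ (Fin n), ⟪A v, w⟫ = ⟪v, A w⟫) (hσ : ∀ v : EuclideanSpace ℝ (Fin n), σ * ‖v‖ ^ 2 ≤ ⟪v, A v⟫)
    {P : EuclideanSpace ℝ (Fin n) → ℝ} (hP : ContDiffOn ℝ 3 P U) (hc : 0 ≤ c)
    (hP3 : ∀ z ∈ K, ∀ w : EuclideanSpace ℝ (Fin n), ‖fderiv ℝ (iteratedFDeriv ℝ 2 P) z w‖ ≤ c * N w) :
    ∀ x ∈ K, ∀ y ∈ K, (⟪x, A x⟫ + P x) + ⟪gradient (fun z : EuclideanSpace ℝ (Fin n) => ⟪z, A z⟫ + P z) x, y - x⟫ +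
        (2 * σ - (‖iteratedFDeriv ℝ 2 P x₀‖ + c * ρ)) / 2 * ‖y - x‖ ^ 2 ≤ ⟪y, A y⟫ + P y := by
  intro x hx y hy
  have hPd : ∀ z ∈ K, DifferentiableAt ℝ P z := fun z hz =>
    (hP.contDiffAt (hU.mem_nhds (hKU hz))).differentiableAt (by norm_num)
  have h := firstOrderOn_add_of_differentiableAt (K := K) (fun z _ => (differentiable_quadratic A hA) z) hPd
    (fun x _ y _ => firstOrder_quadratic A hA hσ x y)
    (firstOrderOn_norm_of_thirdDerivReadingOn_gradient N hU hKU hK h0 hKρ hP hc hP3) x hx y hy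
  have e : (2 * σ + -(‖iteratedFDeriv ℝ 2 P x₀‖ + c * ρ)) / 2 = (2 * σ - (‖iteratedFDeriv ℝ 2 P x₀‖ + c * ρ)) / 2 := by ring
  rw [e] at h
  exact h

end Quadratic

/-! ## §5 The three local ENDs ON `U`: fibre sums, the local table, the model window — leaf-02's readings BY NAME -/

section Local

variable {n : ℕ}

/-- **THE CONVEXITY LETTER ON A SUP-NORM WINDOW FROM FIBRE SUMS, `P ∈ C³(U)` ONLY.**  `U` open, `K ⊆ U` convex, `x₀ ∈ K`,
`‖x − x₀‖_∞ ≤ ρ∞` on `K`; `A` symmetric `σ`-coercive; the third-derivative entries of `P` have fibre sums `≤ M` ON `K` (`0 ≤ M`) ⟹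
modulus `2σ − (‖D²P(x₀)‖ + M·ρ∞)` ON `K` (`…ConvexWindowSuppliersLocal.thirdDeriv_supNorm_of_fibreSums` supplies the reading). [folklore] -/
theorem firstOrderOn_quadratic_add_of_fibreSumsOn (A : EuclideanSpace ℝ (Fin n) →L[ℝ] EuclideanSpace ℝ (Fin n))
    {σ M ρ : ℝ} {U K : Set (EuclideanSpace ℝ (Fin n))} {x₀ : EuclideanSpace ℝ (Fin n)} (hU : IsOpen U) (hKU : K ⊆ U)
    (hK : Convex ℝ K) (h0 : x₀ ∈ K) (hKρ : ∀ x ∈ K, ‖WithLp.ofLp (x - x₀)‖ ≤ ρ)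
    (hA : ∀ v w : EuclideanSpace ℝ (Fin n), ⟪A v, w⟫ = ⟪v, A w⟫) (hσ : ∀ v : EuclideanSpace ℝ (Fin n), σ * ‖v‖ ^ 2 ≤ ⟪v, A v⟫)
    {P : EuclideanSpace ℝ (Fin n) → ℝ} (hP : ContDiffOn ℝ 3 P U) (hM : 0 ≤ M)
    (hrow : ∀ z ∈ K, ∀ j : Fin n, ∑ r ∈ univ.filter (fun r : Fin 3 → Fin n => r 1 = j),
      |iteratedFDeriv ℝ 3 P z (fun s => EuclideanSpace.single (r s) (1 : ℝ))| ≤ M)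
    (hcol : ∀ z ∈ K, ∀ k : Fin n, ∑ r ∈ univ.filter (fun r : Fin 3 → Fin n => r 2 = k),
      |iteratedFDeriv ℝ 3 P z (fun s => EuclideanSpace.single (r s) (1 : ℝ))| ≤ M) :
    ∀ x ∈ K, ∀ y ∈ K, (⟪x, A x⟫ + P x) + ⟪gradient (fun z : EuclideanSpace ℝ (Fin n) => ⟪z, A z⟫ + P z) x, y - x⟫ +
        (2 * σ - (‖iteratedFDeriv ℝ 2 P x₀‖ + M * ρ)) / 2 * ‖y - x‖ ^ 2 ≤ ⟪y, A y⟫ + P y :=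
  firstOrderOn_quadratic_add_of_thirdDerivReadingOn A (fun w => ‖WithLp.ofLp w‖) hU hKU hK h0 hKρ hA hσ hP hM
    (thirdDeriv_supNorm_of_fibreSums hM hrow hcol)

/-- **THE CONVEXITY LETTER OF A LOCAL PERTURBATION `C³` ONLY ON `U`** (`c∞ = ν·τ`): ON `K` the entries of `D³P(z)` vanish off an
interaction set `N`, are bounded by `τ ≥ 0` on `N`, and at most `ν` triples of `N` pass through each middle ∕ last index ⟹ modulus
`2σ − (‖D²P(x₀)‖ + ν·τ·ρ∞)` ON the sup-norm window `K` (`…ConvexWindowSuppliersLocal.thirdDeriv_supNorm_of_local` supplies the reading).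
[folklore] -/
theorem firstOrderOn_quadratic_add_of_localOn (A : EuclideanSpace ℝ (Fin n) →L[ℝ] EuclideanSpace ℝ (Fin n))
    {σ τ ρ : ℝ} {ν : ℕ} {U K : Set (EuclideanSpace ℝ (Fin n))} {x₀ : EuclideanSpace ℝ (Fin n)} (hU : IsOpen U) (hKU : K ⊆ U)
    (hK : Convex ℝ K) (h0 : x₀ ∈ K) (hKρ : ∀ x ∈ K, ‖WithLp.ofLp (x - x₀)‖ ≤ ρ)
    (hA : ∀ v w : EuclideanSpace ℝ (Fin n), ⟪A v, w⟫ = ⟪v, A w⟫) (hσ : ∀ v : EuclideanSpace ℝ (Fin n), σ * ‖v‖ ^ 2 ≤ ⟪v, A v⟫)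
    {P : EuclideanSpace ℝ (Fin n) → ℝ} (hP : ContDiffOn ℝ 3 P U) (Nset : Finset (Fin 3 → Fin n)) (hτ : 0 ≤ τ)
    (hsupp : ∀ z ∈ K, ∀ r, r ∉ Nset → iteratedFDeriv ℝ 3 P z (fun s => EuclideanSpace.single (r s) (1 : ℝ)) = 0)
    (hτb : ∀ z ∈ K, ∀ r ∈ Nset, |iteratedFDeriv ℝ 3 P z (fun s => EuclideanSpace.single (r s) (1 : ℝ))| ≤ τ)
    (hrow : ∀ j : Fin n, (Nset.filter (fun r => r 1 = j)).card ≤ ν)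
    (hcol : ∀ k : Fin n, (Nset.filter (fun r => r 2 = k)).card ≤ ν) :
    ∀ x ∈ K, ∀ y ∈ K, (⟪x, A x⟫ + P x) + ⟪gradient (fun z : EuclideanSpace ℝ (Fin n) => ⟪z, A z⟫ + P z) x, y - x⟫ +
        (2 * σ - (‖iteratedFDeriv ℝ 2 P x₀‖ + ν * τ * ρ)) / 2 * ‖y - x‖ ^ 2 ≤ ⟪y, A y⟫ + P y :=
  firstOrderOn_quadratic_add_of_thirdDerivReadingOn A (fun w => ‖WithLp.ofLp w‖) hU hKU hK h0 hKρ hA hσ hP (by positivity)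
    (thirdDeriv_supNorm_of_local Nset hτ hsupp hτb hrow hcol)

/-- **THE CONVEXITY LETTER OF A LOCAL PERTURBATION ON THE MODEL WINDOW `K = L ∩ box(x₀, a)`, `P ∈ C³(U)` WITH `box(x₀, a) ⊆ U`** —
a linear subspace cut by the coordinate box of half-width `a ≥ 0` about `x₀ ∈ L`; `A` symmetric `σ`-coercive; the third-derivative entries
of `P` ON `K` vanish off `N`, are `≤ τ` on `N`, at most `ν` triples through each middle ∕ last index ⟹ modulus `2σ − (‖D²P(x₀)‖ + ν·τ·a)`
ON `K`.  Displayed: `σ`, `τ`, `ν`, `a`; convexity, centre, sup-norm half-width and `K ⊆ U` are discharged. [folklore] -/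
theorem firstOrderOn_quadratic_add_of_localOn_subspace_inter_coordBox
    (A : EuclideanSpace ℝ (Fin n) →L[ℝ] EuclideanSpace ℝ (Fin n)) (L : Submodule ℝ (EuclideanSpace ℝ (Fin n)))
    {x₀ : EuclideanSpace ℝ (Fin n)} (hx₀ : x₀ ∈ L) {a σ τ : ℝ} {ν : ℕ} (ha : 0 ≤ a) (hτ : 0 ≤ τ)
    (hA : ∀ v w : EuclideanSpace ℝ (Fin n), ⟪A v, w⟫ = ⟪v, A w⟫) (hσ : ∀ v : EuclideanSpace ℝ (Fin n), σ * ‖v‖ ^ 2 ≤ ⟪v, A v⟫)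
    {U : Set (EuclideanSpace ℝ (Fin n))} (hU : IsOpen U) (hboxU : {x | ∀ i : Fin n, |x i - x₀ i| ≤ a} ⊆ U)
    {P : EuclideanSpace ℝ (Fin n) → ℝ} (hP : ContDiffOn ℝ 3 P U) (Nset : Finset (Fin 3 → Fin n))
    (hsupp : ∀ z ∈ (L : Set (EuclideanSpace ℝ (Fin n))) ∩ {x | ∀ i : Fin n, |x i - x₀ i| ≤ a},
      ∀ r, r ∉ Nset → iteratedFDeriv ℝ 3 P z (fun s => EuclideanSpace.single (r s) (1 : ℝ)) = 0)
    (hτb : ∀ z ∈ (L : Set (EuclideanSpace ℝ (Fin n))) ∩ {x | ∀ i : Fin n, |x i - x₀ i| ≤ a},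
      ∀ r ∈ Nset, |iteratedFDeriv ℝ 3 P z (fun s => EuclideanSpace.single (r s) (1 : ℝ))| ≤ τ)
    (hrow : ∀ j : Fin n, (Nset.filter (fun r => r 1 = j)).card ≤ ν)
    (hcol : ∀ k : Fin n, (Nset.filter (fun r => r 2 = k)).card ≤ ν) :
    ∀ x ∈ (L : Set (EuclideanSpace ℝ (Fin n))) ∩ {x | ∀ i : Fin n, |x i - x₀ i| ≤ a},
      ∀ y ∈ (L : Set (EuclideanSpace ℝ (Fin n))) ∩ {x | ∀ i : Fin n, |x i - x₀ i| ≤ a},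
        (⟪x, A x⟫ + P x) + ⟪gradient (fun z : EuclideanSpace ℝ (Fin n) => ⟪z, A z⟫ + P z) x, y - x⟫ +
          (2 * σ - (‖iteratedFDeriv ℝ 2 P x₀‖ + ν * τ * a)) / 2 * ‖y - x‖ ^ 2 ≤ ⟪y, A y⟫ + P y :=
  firstOrderOn_quadratic_add_of_localOn A hU (fun z hz => hboxU hz.2) ((L.convex).inter (convex_coordBox x₀ a))
    ⟨hx₀, fun i => by simpa using ha⟩ (fun x hx => supNorm_sub_le_of_mem_coordBox ha hx.2) hA hσ hP Nset hτ hsupp hτb hrow hcol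

end Local

/-! ## §6 Junction check (kernel): `U = univ` gives back leaf-02's global-`C³` END -/

example {n : ℕ} (A : EuclideanSpace ℝ (Fin n) →L[ℝ] EuclideanSpace ℝ (Fin n)) (N : EuclideanSpace ℝ (Fin n) → ℝ) {σ c ρ : ℝ}
    {K : Set (EuclideanSpace ℝ (Fin n))} {x₀ : EuclideanSpace ℝ (Fin n)} (hK : Convex ℝ K) (h0 : x₀ ∈ K)
    (hKρ : ∀ x ∈ K, N (x - x₀) ≤ ρ) (hA : ∀ v w : EuclideanSpace ℝ (Fin n), ⟪A v, w⟫ = ⟪v, A w⟫)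
    (hσ : ∀ v : EuclideanSpace ℝ (Fin n), σ * ‖v‖ ^ 2 ≤ ⟪v, A v⟫) {P : EuclideanSpace ℝ (Fin n) → ℝ} (hP : ContDiff ℝ 3 P)
    (hc : 0 ≤ c) (hP3 : ∀ z ∈ K, ∀ w : EuclideanSpace ℝ (Fin n), ‖fderiv ℝ (iteratedFDeriv ℝ 2 P) z w‖ ≤ c * N w) :
    ∀ x ∈ K, ∀ y ∈ K, (⟪x, A x⟫ + P x) + ⟪gradient (fun z : EuclideanSpace ℝ (Fin n) => ⟪z, A z⟫ + P z) x, y - x⟫ +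
        (2 * σ - (‖iteratedFDeriv ℝ 2 P x₀‖ + c * ρ)) / 2 * ‖y - x‖ ^ 2 ≤ ⟪y, A y⟫ + P y :=
  firstOrderOn_quadratic_add_of_thirdDerivReadingOn A N isOpen_univ (subset_univ K) hK h0 hKρ hA hσ hP.contDiffOn hc hP3

end Summit.QuantumFields.BalabanUV.T4Continuum.NE7b.WindowHessianFromThirdDerivReading
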